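import Summits.BirchSwinnertonDyer.BirchSwinnertonDyer.Theorems.EisensteinPrimesBSDpOnCellCImprimitiveCountSplitOfBrHlatLight
import Summits.BirchSwinnertonDyer.BirchSwinnertonDyer.Theorems.CumulativeHeegnerLeopoldtCumulativeHeegnerInclusionAtThreeStubResidualSelmerFiniteLineDeterminant
import Summits.BirchSwinnertonDyer.BirchSwinnertonDyer.Theorems.EisensteinPrimesGoodLatticeOmegaPrelims
import Literature.NumberTheory.EllipticCurves.SigmaEulerData
import Literature.NumberTheory.EllipticCurves.CastellaGrossiLeeSkinner2022.OmegaPartnerCharacterSelmerLambda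
import HarnessLib

/-!
# Crux 4 `BSDpOnCellC` (stmt-BirchSwinnertonDyer-19034), line crystal v6 — [BRω-mult] BY NAME FROM PRINT: the registered conjunct
# `stub_wallAlgebraic.2.1` (the LIGHT [BRω-mult] text) follows from ONE published named fact of Castella–Grossi–Lee–Skinner 2022
# (cell `bsd-eis`, width seat `bsd-line-x2-p2` gen 12; skeleton UNCHANGED, W-79)

WHY. Crystal v6 (LEAD `cruxlead-19034` g0, registered 2026-08-29T01:29:40Z) has the wall stub `stub_wallAlgebraic` = [BR𝟙] ∧ [BRω-mult]-LIGHT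
∧ [BRω-split]-LIGHT, «three CHARACTER main conjectures». The middle one is NOT preprint-grade: at a NON-split multiplicative Eisenstein prime
`p` the `p`-ramified member `ψ` of the residual pair has `ψ|_{G_p} = ωδ` (`δ` the non-trivial unramified quadratic character), i.e. `ψ|_{G_v̄}`
lies INSIDE the printed regime `∉ {𝟙, ω}` of CGLS 2022 Thm. 1.2.2 (Rubin 1991 + Hida 2010), and `λ(𝔛_ψ) = λ(𝓛_ψ) = λ(𝓛_φ)` is Rubin's main
conjecture followed by the functional equation (2.16), both sentences printed in CGLS's proofs of Thms. 2.2.2–2.2.3 (Invent. Math. 227). This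
seat typed that character-level composition ONCE as the Literature named fact
`CastellaGrossiLeeSkinner2022.thm122_fe_omegaPartner_charGrDual_torsion_muZero_lambda_eq` (no curve occurs in it) and derives here crystal v6's
`stub_wallAlgebraic.2.1` VERBATIM from it. Hence for the LEAD (v7/v8, by name):
`stub_wallAlgebraic.2.1 := BrOmegaMultOfPrint.brOmegaMult_light_of_print <the new PUB conjunct>` — the wall shrinks to [BR𝟙] ∧ [BRω-split]
(both Keller–Yin's ANOMALOUS regime, genuinely preprint-grade), the new fact joining `stub_publishedFacts.2`.

THE DERIVATION. Given the [BRω-mult] datum (`W`, `2 < p`, `p ‖ N` non-split, `K`, `κ`, `γ`, `𝔭 = v` with `e = f = 1`, `𝔭̄ = v̄`, `ι'`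
inducing `𝔭`, a rational line `Φ` with its Teichmüller pair `(θsub, θquot)`, an orientation `(φ, ψ)` with `φ` unramified at `p`, `θ_K`,
`Cbar`, a Katz frame `Lφ` with first unit index `nφ`, a primitive unramified dual datum `Dψ` of `ψ|_{G_K}` at `v̄`): (1) `ι : K → ℚ_p`
inducing `𝔭` (`X11b.embAt`); (2) both members are Teichmüller (`hs.1`, `hq.1`); (3) **`φ·ψ ≡ χ_p` residually** (§1
`exists_entry_mul_eq_cyclotomic`: `det ρ̄_{E,p} = ω` on `0 → Φ → E[p] → E[p]/Φ → 0`, via the CHL stub-B1 determinant lemma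
`smul_sub_nsmul_mem_of_smul_sub_eq`); (4) both members unramified at every `ℓ ∤ N` (Néron–Ogg–Shafarevich: `isUnramifiedAt_of_isTeichmullerLiftOn`
/ `…OnQuot`; `p ∣ N` so `ℓ ∤ N ⇒ ℓ ≠ p`), `N` Heegner; (5) **`ψ|_{G_v̄} ∉ {𝟙, ω}`** from the non-split Tate datum transported to `K`
(`CharGrSelmerLambdaRelaxation.charHypotheses_of_not_split`, g9/g10, unconditional); (6) the named fact gives f.g. / torsion / `μ = 0` /
`λ = nφ` for every STRICT dual datum of `ψ|_{G_K}` at `v̄`; (7) transfer to the UNRAMIFIED dual datum `Dψ` along the tree theorem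
`H¹_{𝓕_Gr} = H¹_{𝓕_nr}` for `ψ|_{G_v̄} ≠ 𝟙` (`StrictEqUnramifiedCentral.grSelmer_charModule_eq_unrSelmer`, `prop_datumDualData_of_forall_grDualData`).

HONEST FRAMING: helper theorems only (0 defs, 0 sorry); §2 is CONDITIONAL on the one named PUBLISHED fact (CGLS 2022 Thm. 1.2.2 + proof
sentences of Thms. 2.2.2–2.2.3; behind them Rubin 1991, Hida 2010, Katz's functional equation); closes no stub by itself (the skeleton is the
LEAD's); no summit statement / BSD / MC / IMC is proved for any curve; 0 cells / labels / tiers move.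

References: [CastellaGrossiLeeSkinner2022] Thm. 1.2.2, §2.2 Thms. 2.2.1–2.2.3 with (2.16), Thm. 2.1.2; [Rubin1991] Thm. 4.1; [Hida2010MuInvariant]
Thm. I; [Kriz2016] Thm. 27; [KellerYin2024] §1.4, §2.3, §5.1 (b) (arXiv:2402.12781v2; shape of the wall only); [SilvermanAEC2009] III.8 (Weil
pairing, det ρ̄ = ω), VII.4.1; [GreenbergVatsal2000] §2 p. 17; p666804, p670160, p665096 (g9), p684333 (LEAD), crystal v6 `Lines/crystal.lean`.
-/

set_option autoImplicit false
set_option linter.dupNamespace false -- the summit namespace `…BirchSwinnertonDyer.BirchSwinnertonDyer.Theorems` (Sub = Summit, D-0017) trips it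

noncomputable section

open scoped Classical MatrixGroups ModularForm

open CongruenceSubgroup WeierstrassCurve NumberField IsDedekindDomain Field PowerSeries
  Literature.NumberTheory.EllipticCurves Literature.NumberTheory.EllipticCurves.GreenbergSelmer
  Literature.NumberTheory.EllipticCurves.ModularForms Literature.NumberTheory.QuadraticFields
  Literature.NumberTheory.EllipticCurves.Rank1Residual
  Literature.NumberTheory.EllipticCurves.Rank1Residual.Typed
  Literature.NumberTheory.EllipticCurves.KrizLi2019
  Literature.NumberTheory.EllipticCurves.GreenbergVatsal2000
  Literature.NumberTheory.EllipticCurves.Wuthrich2014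
  Literature.NumberTheory.EllipticCurves.SteinWuthrich2013
  Literature.NumberTheory.EllipticCurves.Castella2018Exceptional
  Literature.NumberTheory.EllipticCurves.Castella2018
  Literature.NumberTheory.GaloisRepresentations Literature.NumberTheory.GaloisCohomology
  Literature.NumberTheory.Automorphic
  Literature.NumberTheory.EllipticCurves.CastellaGrossiLeeSkinner2022
  Literature.NumberTheory.IwasawaTheory Literature.NumberTheory.IwasawaTheory.Greenberg2016
  Literature.NumberTheory.IwasawaTheory.Greenberg2006
  Summit.BirchSwinnertonDyer.Rank1Residual.X11b.AcSelmer
  Summit.BirchSwinnertonDyer.Rank1Residual.X11b.Halves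
  Summit.BirchSwinnertonDyer.Rank1Residual.X11b
  Summit.BirchSwinnertonDyer.Rank1Residual Summit.BirchSwinnertonDyer.Rank1Residual.X1
  Summit.BirchSwinnertonDyer.Rank1Residual.X1.KellerYinMuLambdaSplit
  Summit.BirchSwinnertonDyer.Rank1Residual.X2
  Summit.BirchSwinnertonDyer.Rank1Residual.X2.ResidualDevissageModules
  Summit.BirchSwinnertonDyer.BirchSwinnertonDyer.Theorems
  Summit.BirchSwinnertonDyer.BirchSwinnertonDyer.Theorems.EisensteinPrimesMuLambda
open Literature.NumberTheory.EllipticCurves.KellerYin2024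

namespace Summit.BirchSwinnertonDyer.BirchSwinnertonDyer.Theorems.BrOmegaMultOfPrint

/-! ## §1 `det ρ̄ = ω` on a Teichmüller pair: `φ·ψ ≡ χ_p` residually -/

/-- **`φ·ψ ≡ χ_p (mod 𝔪)` for the Teichmüller pair of a rational `p`-line** — CGLS's «`ψ = φ⁻¹ω`» / Keller–Yin's
«`0 → 𝔽(φ) → ρ̄_f → 𝔽(ψ) → 0`» read with `det ρ̄_{E,p} = ω`: for `E/ℚ`, a rational line `Φ ≤ E[p]` and Teichmüller lifts `θsub`
(of the character on `Φ`) and `θquot` (of the character on `E[p]/Φ`), for every `σ ∈ Γ_ℚ` there are integers `a ≡ θsub(σ)`,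
`b ≡ θquot(σ)` (mod the maximal ideal) with `a·b ≡ χ_p(σ) (mod p)`. Proof: `σ` acts on the line by `a ≢ 0`; the CHL determinant lemma
(`smul_sub_nsmul_mem_of_smul_sub_eq`, Weil pairing) makes `σ` act on `E[p]/Φ` by `χ_p(σ)·a⁻¹`; comparing with `b` on a point outside the
line gives `b ≡ χ_p(σ)·a⁻¹`. [cite: SilvermanAEC2009, III.8 (Weil pairing: det ρ̄_{E,p} = χ_p)]
[cite: CastellaGrossiLeeSkinner2022, Thm. 2.2.1 and proof of Thm. 2.2.2 ("since ψ = φ⁻¹ω")] [cite: KellerYin2024, §1.4 (arXiv:2402.12781v2 TeX L1063–1086)] -/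
theorem exists_entry_mul_eq_cyclotomic (W : WeierstrassCurve ℚ) [W.IsElliptic] {p : ℕ} [hp : Fact p.Prime]
    {Φ : AddSubgroup (geomTorsion W (p : ℤ))} (hΦ : IsRationalLine W p Φ)
    {θsub θquot : FramedGaloisRep ℚ (padicCoeffIntegers (∅ : Set (PadicAlgCl p))) 1}
    (hs : IsTeichmullerLiftOn (∅ : Set (PadicAlgCl p)) (Φ.map (geomTorsion W (p : ℤ)).subtype) θsub)
    (hq : IsTeichmullerLiftOnQuot (∅ : Set (PadicAlgCl p)) (Φ.map (geomTorsion W (p : ℤ)).subtype)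
      (geomTorsion W (p : ℤ)) θquot)
    (σ : absoluteGaloisGroup ℚ) :
    ∃ a b : ℤ,
      ‖((entry (∅ : Set (PadicAlgCl p)) θsub σ : padicCoeffIntegers (∅ : Set (PadicAlgCl p))) : PadicAlgCl p) -
          (a : PadicAlgCl p)‖ < 1 ∧
        ‖((entry (∅ : Set (PadicAlgCl p)) θquot σ : padicCoeffIntegers (∅ : Set (PadicAlgCl p))) : PadicAlgCl p) -
          (b : PadicAlgCl p)‖ < 1 ∧
        ((a * b : ℤ) : ZMod p) = ((modNCyclotomicCharacter ℚ p σ : (ZMod p)ˣ) : ZMod p) := by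
  have hpp : p.Prime := hp.out
  obtain ⟨a, ha, hsa⟩ := hs.exists_smul_eq σ
  obtain ⟨b, hb, hqb⟩ := hq.2 σ
  refine ⟨a, b, ha, hb, ?_⟩
  -- the line as a stable subgroup of `E[p]`, `σ` acting on it by `a`
  let L : StableSubgroup (absoluteGaloisGroup ℚ) (geomTorsion W (p : ℤ)) :=
    { toAddSubgroup := Φ, smul_mem' := fun g _ hm ↦ hΦ.2 g _ hm }
  have hL : Nat.card L.Sub = p := hΦ.1
  have hacta : ∀ c : L.Sub, σ • c = a • c := fun c ↦ L.incl_injective (by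
    rw [L.incl_smul, map_zsmul]
    apply Subtype.ext
    rw [AddSubgroup.torsionBy.coe_smul, AddSubgroupClass.coe_zsmul]
    exact hsa _ ⟨L.incl c, c.2, rfl⟩)
  have hpc : ∀ c : L.Sub, p • c = 0 := fun c ↦ by
    have h := addOrderOf_dvd_natCard c
    rw [hL] at h
    exact addOrderOf_dvd_iff_nsmul_eq_zero.mp h
  -- `k = a mod p`, `σ = k` on the line
  set k : ℕ := (a : ZMod p).val with hkdef
  have hka : ((k : ℕ) : ZMod p) = (a : ZMod p) := ZMod.natCast_zmod_val _
  have hk : ∀ c : L.Sub, σ • c = k • c := by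
    intro c
    rw [hacta c]
    have hdvd : (p : ℤ) ∣ a - k := by
      rw [← ZMod.intCast_zmod_eq_zero_iff_dvd]; push_cast; rw [hka, sub_self]
    obtain ⟨d, hd⟩ := hdvd
    have hpc' : (p : ℤ) • c = 0 := by rw [natCast_zsmul]; exact hpc c
    have e : a = (k : ℤ) + (p : ℤ) * d := by linear_combination hd
    rw [e, add_zsmul, mul_comm, mul_zsmul, hpc', zsmul_zero, add_zero, natCast_zsmul]
  -- `a ≢ 0 (mod p)`: `σ` is injective on the (non-trivial) line
  have hk0 : (a : ZMod p) ≠ 0 := by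
    intro h0
    have hk00 : k = 0 := by rw [hkdef, h0, ZMod.val_zero]
    haveI : Finite L.Sub := Nat.finite_of_card_ne_zero (by rw [hL]; exact hpp.ne_zero)
    have h1L : 1 < Nat.card L.Sub := by rw [hL]; exact hpp.one_lt
    haveI : Nontrivial L.Sub := Finite.one_lt_card_iff_nontrivial.mp h1L
    obtain ⟨c, hc⟩ := exists_ne (0 : L.Sub)
    apply hc
    have h1 : σ • c = 0 := by rw [hk c, hk00, zero_smul]
    have h2 := congrArg (σ⁻¹ • ·) h1
    simpa only [inv_smul_smul, smul_zero] using h2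
  -- the quotient scalar `k'` with `k k' = χ_p(σ)` (CHL determinant lemma)
  set ω : ZMod p := ((modNCyclotomicCharacter ℚ p σ : (ZMod p)ˣ) : ZMod p) with hωdef
  set k' : ℕ := (ω * ((a : ZMod p))⁻¹).val with hk'def
  have hkk' : ((k : ℕ) : ZMod p) * ((k' : ℕ) : ZMod p) = ω := by
    have e : ((k' : ℕ) : ZMod p) = ω * ((a : ZMod p))⁻¹ := by rw [hk'def, ZMod.natCast_zmod_val]
    rw [e, hka, mul_comm, inv_mul_cancel_right₀ hk0]
  have hquot : ∀ P : geomTorsion W (p : ℤ), σ • P - k' • P ∈ Φ := fun P ↦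
    CumulativeHeegnerInclusionAtThreeStubB1LineDeterminant.smul_sub_nsmul_mem_of_smul_sub_eq W p L hL σ k k' hkk' hk P
  -- compare with `b` on a point of `E[p]` outside the line
  have hcardΦ : Nat.card (Φ.map (geomTorsion W (p : ℤ)).subtype) = p := by
    rw [Nat.card_congr (Φ.equivMapOfInjective (geomTorsion W (p : ℤ)).subtype
      (geomTorsion W (p : ℤ)).subtype_injective).toEquiv.symm, hΦ.1]
  obtain ⟨P, hP, hPΦ⟩ := exists_mem_geomTorsion_notMem W (p := p) hcardΦ
  have h1 : σ • P - b • P ∈ Φ.map (geomTorsion W (p : ℤ)).subtype := hqb P hP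
  have h2 : σ • P - (k' : ℤ) • P ∈ Φ.map (geomTorsion W (p : ℤ)).subtype := by
    refine ⟨σ • ⟨P, hP⟩ - k' • ⟨P, hP⟩, hquot ⟨P, hP⟩, ?_⟩
    rw [map_sub, map_nsmul, AddSubgroup.subtype_apply, AddSubgroup.subtype_apply, AddSubgroup.torsionBy.coe_smul,
      natCast_zsmul]
  have h3 : (b - k' : ℤ) • P ∈ Φ.map (geomTorsion W (p : ℤ)).subtype := by
    have h := (Φ.map (geomTorsion W (p : ℤ)).subtype).sub_mem h2 h1
    rwa [sub_sub_sub_cancel_left, ← sub_smul] at h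
  have hdvd : (p : ℤ) ∣ b - k' := prime_dvd_of_zsmul_mem W hP hPΦ h3
  have hbk' : (b : ZMod p) = ((k' : ℕ) : ZMod p) := by
    have h := (ZMod.intCast_zmod_eq_zero_iff_dvd _ p).mpr hdvd
    push_cast at h
    exact sub_eq_zero.mp h
  calc ((a * b : ℤ) : ZMod p) = (a : ZMod p) * (b : ZMod p) := by push_cast; rfl
    _ = ((k : ℕ) : ZMod p) * ((k' : ℕ) : ZMod p) := by rw [hka, hbk']
    _ = ω := hkk'

/-! ## §2 [BRω-mult]-LIGHT (crystal v6 `stub_wallAlgebraic.2.1`, VERBATIM) from the named fact -/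

/-- **[BRω-mult] BY NAME FROM PRINT.** Crystal v6's `stub_wallAlgebraic.2.1` — at every NON-split multiplicative odd Eisenstein datum
(`W`, `p`, `K` imaginary quadratic Heegner for `N_W` with `D_K` odd `≠ −3`, `κ` anticyclotomic, `γ`, `𝔭 = v` of degree one, `𝔭̄ = v̄`,
`(p)` split, `ι'` inducing `𝔭`), for every rational line `Φ` with Teichmüller pair `(θsub, θquot)`, every orientation `(φ, ψ)` with `φ`
unramified at `p`, every Hecke character `θ_K` of `φ|_{G_K}`, every `Cbar`, every Katz frame `Lφ` with first unit index `nφ`: EVERY primitive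
unramified dual datum `Dψ` of `ψ|_{G_K}` at `v̄` is finitely generated `Λ`-torsion with `μ = 0` and `λ = nφ` — FOLLOWS from the published
named fact `CastellaGrossiLeeSkinner2022.thm122_fe_omegaPartner_charGrDual_torsion_muZero_lambda_eq` (CGLS Thm. 1.2.2 + Rubin's `λ`-clause +
(2.16)). Steps (1)–(7) of the module docstring; the two non-bookkeeping inputs are §1 (`φ·ψ ≡ χ_p`) and the non-split local regime
`ψ|_{G_v̄} ∉ {𝟙, ω}` (`charHypotheses_of_not_split`). The conclusion is token-for-token the conjunct `.2.1` of crystal v6's `stub_wallAlgebraic`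
(= the hypothesis `hωN` of x2-p2 g11's `ImprimitiveCountWallOfInputs.stub_imprimitiveCount_of_pub_of_br_of_an`, = the LEAD's light text bridged
to p668130'' by `KellerYinBROmegaLightBridges.brOmegaMult_heavy_of_light`).
[cite: CastellaGrossiLeeSkinner2022, Thm. 1.2.2 (Rubin, Hida), proof of Thm. 2.2.3 (λ(𝔛_ψ) = λ(𝓛_ψ)), proof of Thm. 2.2.2 display (2.16) (λ(𝓛_ψ) = λ(𝓛_φ))]
[cite: KellerYin2024, §2.3 and §5.1 (b) (arXiv:2402.12781v2) (shape of the wall only)] [cite: GreenbergVatsal2000, §2 p. 17 and Prop. (2.4)]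
[cite: SilvermanATAEC1994, Ch. V Thm. 5.3 (non-split Tate curve: the local characters ωδ, δ)] -/
theorem brOmegaMult_light_of_print
    (hfe : thm122_fe_omegaPartner_charGrDual_torsion_muZero_lambda_eq) :
    ∀ (W : WeierstrassCurve ℚ) [W.IsElliptic] [W.IsGloballyMinimal] (p : ℕ) [Fact p.Prime],
      2 < p → Mult W p → ¬ W.HasSplitMultiplicativeReductionAtPrime p →
      ∀ (K : Type) [Field K] [NumberField K],
        IsImaginaryQuadratic K → SatisfiesHeegnerHypothesis (W.conductorNorm ℤ) K →
        Odd (NumberField.discr K) → NumberField.discr K ≠ -3 →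
        ∀ (κ : ZpExtension K p), κ.IsAnticyclotomic →
          ∀ (γ : Field.absoluteGaloisGroup K) [Fact (κ.IsTopGenerator γ)]
            (𝔭 : HeightOneSpectrum (𝓞 K)), ((p : ℕ) : 𝓞 K) ∈ 𝔭.asIdeal →
            𝔭.asIdeal.ramificationIdx (𝓞 ℚ) = 1 → 𝔭.asIdeal.inertiaDeg (𝓞 ℚ) = 1 →
            ∀ (𝔭bar : HeightOneSpectrum (𝓞 K)), ((p : ℕ) : 𝓞 K) ∈ 𝔭bar.asIdeal → 𝔭bar ≠ 𝔭 →
              ((Ideal.span {(p : ℤ)}).primesOver (𝓞 K)).ncard = 2 →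
            ∀ (ι' : PadicAlgCl p ≃+* ℂ),
              (∀ (w : InfinitePlace K) (k : 𝓞 K), k ∈ 𝔭.asIdeal ↔ ‖ι'.symm (w.embedding (k : K))‖ < 1) →
            ∀ (Φ : AddSubgroup (geomTorsion W (p : ℤ))), IsRationalLine W p Φ →
            ∀ (θsub θquot : FramedGaloisRep ℚ (padicCoeffIntegers (∅ : Set (PadicAlgCl p))) 1),
              IsTeichmullerLiftOn (∅ : Set (PadicAlgCl p)) (Φ.map (geomTorsion W (p : ℤ)).subtype) θsub →
              IsTeichmullerLiftOnQuot (∅ : Set (PadicAlgCl p)) (Φ.map (geomTorsion W (p : ℤ)).subtype)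
                (geomTorsion W (p : ℤ)) θquot →
            ∀ (φ ψ : FramedGaloisRep ℚ (padicCoeffIntegers (∅ : Set (PadicAlgCl p))) 1),
              (φ = θsub ∧ ψ = θquot ∨ φ = θquot ∧ ψ = θsub) →
              (∀ u : HeightOneSpectrum (𝓞 ℚ), ((p : ℕ) : 𝓞 ℚ) ∈ u.asIdeal → φ.IsUnramifiedAt u) →
            ∀ (θK : HeckeCharacter K), IsHeckeCharOf ι' (φ.restrictField K) θK →
            ∀ (Cbar : Finset (HeightOneSpectrum (𝓞 K))), (∀ u ∈ Cbar, ¬ θK.IsUnramifiedAt u) →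
            ∀ (ΩK' : ℂ) (Ωp' : (unrIntegers p)ˣ) (Lφ : UnrSeries p), ΩK' ≠ 0 →
              IsKatzLFunction ι' 𝔭 𝔭bar Cbar κ γ θK ΩK' ((Ωp' : unrIntegers p) : ℂ_[p]) Lφ →
            ∀ nφ : ℕ, FirstUnitCoeffAt Lφ nφ →
            ∀ (Dψ : DatumDualData κ γ (charModule (∅ : Set (PadicAlgCl p)) (ψ.restrictField K))
                (Castella2018.AcSelmer.bdpData (charModule (∅ : Set (PadicAlgCl p)) (ψ.restrictField K)) p 𝔭bar)
                (∅ : Set (HeightOneSpectrum (𝓞 K)))),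
              Module.Finite (IwasawaAlgebra p) Dψ.X ∧ Module.IsTorsion (IwasawaAlgebra p) Dψ.X ∧
                muInvariant p Dψ.X = 0 ∧ lambdaInvariant p Dψ.X = nφ := by
  intro W _ _ p _ hp2 hmult hns K _ _ hK hHN hodd hd3 κ hκ γ _ 𝔭 h𝔭 he1 hf1 𝔭bar h𝔭bar hne hsplit ι' hι' Φ hΦ θsub θquot hs hq
    φ ψ hor hφp θK hθK Cbar hCbar ΩK' Ωp' Lφ hΩK' hL nφ hnφ Dψ
  have hpp : p.Prime := Fact.out
  haveI : IsGalois ℚ K := isGalois_of_finrank_eq_two K hK.1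
  -- (1) the embedding `ι : K → ℚ_p` inducing `𝔭`, and (Heeg) for `p`
  set ι : K →+* ℚ_[p] := X11b.embAt K p 𝔭 h𝔭 he1 hf1 with hιdef
  have hvι : ∀ x : 𝓞 K, x ∈ 𝔭.asIdeal ↔ ‖ι (x : K)‖ < 1 := X11b.mem_asIdeal_iff_norm_embAt_lt_one 𝔭 h𝔭 he1 hf1
  have hHp : SatisfiesHeegnerHypothesis p K := fun q hq hqp ↦ by
    rw [(Nat.prime_dvd_prime_iff_eq hq hpp).mp hqp]; exact hsplit
  -- (2) Teichmüller; (3) `φ·ψ ≡ χ_p`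
  have hTs : ∀ σ : absoluteGaloisGroup ℚ, θsub σ ^ (p - 1) = 1 := hs.1
  have hTq : ∀ σ : absoluteGaloisGroup ℚ, θquot σ ^ (p - 1) = 1 := hq.1
  have hprod0 := fun σ ↦ exists_entry_mul_eq_cyclotomic W hΦ hs hq σ
  -- (4) both members unramified at every `ℓ ∤ N`
  have hcardΦ : Nat.card (Φ.map (geomTorsion W (p : ℤ)).subtype) = p := by
    rw [Nat.card_congr (Φ.equivMapOfInjective (geomTorsion W (p : ℤ)).subtype
      (geomTorsion W (p : ℤ)).subtype_injective).toEquiv.symm, hΦ.1]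
  have hle : Φ.map (geomTorsion W (p : ℤ)).subtype ≤ geomTorsion W (p : ℤ) := by
    rintro _ ⟨Q, -, rfl⟩; exact Q.2
  have hpN : p ∣ W.conductorNorm ℤ := X11b.dvd_conductorNorm_of_mult (W := W) hmult
  have hpu : ∀ u : HeightOneSpectrum (𝓞 ℚ), ((W.conductorNorm ℤ : ℤ) : 𝓞 ℚ) ∉ u.asIdeal →
      ((p : ℕ) : 𝓞 ℚ) ∉ u.asIdeal := by
    intro u hu hpu
    apply hu
    obtain ⟨c, hc⟩ := hpN
    have e : ((W.conductorNorm ℤ : ℤ) : 𝓞 ℚ) = ((p : ℕ) : 𝓞 ℚ) * (c : 𝓞 ℚ) := by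
      rw [hc]; push_cast; rfl
    rw [e]
    exact u.asIdeal.mul_mem_right _ hpu
  have hunrs : ∀ u : HeightOneSpectrum (𝓞 ℚ), ((W.conductorNorm ℤ : ℤ) : 𝓞 ℚ) ∉ u.asIdeal → θsub.IsUnramifiedAt u :=
    fun u hu ↦ isUnramifiedAt_of_isTeichmullerLiftOn W (∅ : Set (PadicAlgCl p)) hcardΦ hle hs
      (hasGoodReductionAt_of_conductorNorm_notMem W u hu) (hpu u hu)
  have hunrq : ∀ u : HeightOneSpectrum (𝓞 ℚ), ((W.conductorNorm ℤ : ℤ) : 𝓞 ℚ) ∉ u.asIdeal → θquot.IsUnramifiedAt u :=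
    fun u hu ↦ isUnramifiedAt_of_isTeichmullerLiftOnQuot W (∅ : Set (PadicAlgCl p)) hcardΦ hq
      (hasGoodReductionAt_of_conductorNorm_notMem W u hu) (hpu u hu)
  -- (5) the non-split local regime at `v̄` for both members of the pair over `K`
  have hpair : IsResidualPairOver (W.baseChange K) p (θsub.restrictField K) (θquot.restrictField K) :=
    isResidualPairOver_restrictField W p K hΦ hs hq
  have hSf : ∀ w : HeightOneSpectrum (𝓞 K), w ∈ W.sigmaPlacesFinset p K ↔
      (((W.conductorNorm ℤ : ℤ) : 𝓞 K) ∈ w.asIdeal ∧ ((p : ℕ) : 𝓞 K) ∉ w.asIdeal) := fun w ↦ by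
    rw [mem_sigmaPlacesFinset_iff, mem_sigmaPlaces_iff, Int.cast_natCast]
  obtain ⟨-, hchar⟩ := CharGrSelmerLambdaRelaxation.charHypotheses_of_not_split W K 𝔭bar κ (W.sigmaPlacesFinset p K) hp2 hmult
    hns hK hHN hsplit h𝔭bar hSf (θsub.restrictField K) (θquot.restrictField K) hpair
  -- the property transported from strict to unramified dual data
  let P : ∀ (X : Type) [AddCommGroup X] [Module (IwasawaAlgebra p) X], Prop := fun X _ _ ↦
    Module.Finite (IwasawaAlgebra p) X ∧ Module.IsTorsion (IwasawaAlgebra p) X ∧ muInvariant p X = 0 ∧ lambdaInvariant p X = nφ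
  rcases hor with ⟨rfl, rfl⟩ | ⟨rfl, rfl⟩
  · -- `φ = θsub` (unramified at `p`), `ψ = θquot` (after the substitution the pair is named `(φ, ψ)`)
    obtain ⟨-, -, hne1, hneω⟩ := hchar (ψ.restrictField K) (Or.inr rfl)
    have hall := hfe p hp2 K hK hHp hodd hd3 ι 𝔭 𝔭bar hvι h𝔭bar hne κ hκ γ ι' hι' φ ψ hTs hTq hprod0
      (W.conductorNorm ℤ) hHN hunrs hφp hunrq hne1 hneω θK hθK Cbar hCbar ΩK' Ωp' Lφ hΩK' hL nφ hnφ
    have hbridge := StrictEqUnramifiedCentral.grSelmer_charModule_eq_unrSelmer κ 𝔭bar (∅ : Set (HeightOneSpectrum (𝓞 K)))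
      (ψ.restrictField K) (fun σ ↦ hTq _) hne1
    exact StrictEqUnramifiedCentral.prop_datumDualData_of_forall_grDualData κ 𝔭bar (∅ : Set (HeightOneSpectrum (𝓞 K))) hbridge
      P hall Dψ
  · -- `φ = θquot` (unramified at `p`), `ψ = θsub` (after the substitution the pair is named `(ψ, φ)`)
    obtain ⟨-, -, hne1, hneω⟩ := hchar (ψ.restrictField K) (Or.inl rfl)
    have hprod : ∀ σ : absoluteGaloisGroup ℚ, ∃ a b : ℤ,
        ‖((entry (∅ : Set (PadicAlgCl p)) φ σ : padicCoeffIntegers (∅ : Set (PadicAlgCl p))) : PadicAlgCl p) -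
            (a : PadicAlgCl p)‖ < 1 ∧
          ‖((entry (∅ : Set (PadicAlgCl p)) ψ σ : padicCoeffIntegers (∅ : Set (PadicAlgCl p))) : PadicAlgCl p) -
            (b : PadicAlgCl p)‖ < 1 ∧
          ((a * b : ℤ) : ZMod p) = ((modNCyclotomicCharacter ℚ p σ : (ZMod p)ˣ) : ZMod p) := fun σ ↦ by
      obtain ⟨a, b, ha, hb, hab⟩ := hprod0 σ
      exact ⟨b, a, hb, ha, by rw [mul_comm]; exact hab⟩
    have hall := hfe p hp2 K hK hHp hodd hd3 ι 𝔭 𝔭bar hvι h𝔭bar hne κ hκ γ ι' hι' φ ψ hTq hTs hprod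
      (W.conductorNorm ℤ) hHN hunrq hφp hunrs hne1 hneω θK hθK Cbar hCbar ΩK' Ωp' Lφ hΩK' hL nφ hnφ
    have hbridge := StrictEqUnramifiedCentral.grSelmer_charModule_eq_unrSelmer κ 𝔭bar (∅ : Set (HeightOneSpectrum (𝓞 K)))
      (ψ.restrictField K) (fun σ ↦ hTs _) hne1
    exact StrictEqUnramifiedCentral.prop_datumDualData_of_forall_grDualData κ 𝔭bar (∅ : Set (HeightOneSpectrum (𝓞 K))) hbridge
      P hall Dψ

end Summit.BirchSwinnertonDyer.BirchSwinnertonDyer.Theorems.BrOmegaMultOfPrint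

end
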